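import Summits.CriticalPhenomena.PercolationContinuityZ3.Theorems.Transplant.PlanarSkeletonFrmFromDefs
import Summits.CriticalPhenomena.PercolationContinuityZ3.Theorems.Transplant.SkelFrmFromBParamsFoot
import Summits.CriticalPhenomena.PercolationContinuityZ3.Theorems.Transplant.SkelFrmBParamsFoot
import Summits.CriticalPhenomena.PercolationContinuityZ3.Theorems.Transplant.SkelFrmFromBParamsSlotsT
import Summits.CriticalPhenomena.PercolationContinuityZ3.Theorems.Transplant.SkelFrmBParamsSlotsT
import Summits.CriticalPhenomena.PercolationContinuityZ3.Theorems.Transplant.SkelNegBParamsFaceTop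
import HarnessLib
import Summits.CriticalPhenomena.PercolationContinuityZ3.Theorems.Transplant.SkelFrmBParamsFaceTop
/-!
# U-WAVE PORT (RULING D-U, lead g21 2026-08-26; WAVE-U-MANIFEST v3.1 row «SkelFrmBParamsFaceTop» ↦ «SkelFrmFromBParamsFaceTop») of the tree module
# `Transplant/SkelFrmBParamsFaceTop` onto the carrier `PlanarSkeletonFrmFrom` (frames only, cylinders connected from width `ℓ₀` on)

ORIGINAL TITLE: N2 (frames-only node `SamePDropOfSkeletonFrmFrom₁`, OPEN) params column over `PlanarSkeletonFrm` — (ζ″) ledger, shape (B′) of record ((R-14)):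

builds on p205010 (kernel theorem, internal audit signed; external expert review pending) — nothing in this file uses p205010; NOTHING is claimed about the
OPEN node U `SamePDropOfSkeletonFrmFrom₁` (nor U_s / the end state).  Lane `prim-bschramm`, seat `prim-bschramm-stmt` gen 26 (port pen, RULING M-11 family P-stmt; tool = p3-g26's port_u.py of record, registry-driven inputs); helper file
(`--supports stmt-CriticalPhenomena-4575 --as helper`).  PORT RULES r1–r4 of RULING D-U: declaration order and proof texts are those of the original,
byte-identical except (i) the carrier token `PlanarSkeletonFrm ↦ PlanarSkeletonFrmFrom` (binders, `namespace`/`end` lines, qualified names of twinned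
declarations), (ii) carrier-FREE declarations of the original (φ-level `Skelφ…` blocks and namespace-only arithmetic residents) are NOT re-declared —
this file imports the original and `export`s the twin-free residents (POLICY T / treatment (m1)); residents whose statement mentions a twinned
constant are copied, (iii) every carrier-binding declaration keeps its explicit binder `(Φ : PlanarSkeletonFrmFrom G)` in its own signature (r2).  Docstrings and citations are the original's.
-/

noncomputable section

open scoped Classical

namespace Summit.CriticalPhenomena.PercolationContinuityZ3.Theorems.Transplant

namespace PlanarSkeletonFrmFrom

namespace NegB

open Literature.Probability.Percolation Literature.Probability.LatticeModels SimpleGraph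
open SkelConc (Consts)
open Skelφ (shearUnit)
open Skelφ.StepI (DataN)
open TwoAxis.Para (modulus)
open Neg

/-! ## §1 The lattice record's unit / determinant / top-layer facts -/

section Lattice

/-- **The top-layer sandwich** `n_Lℓ_L − U_L + 1 ≤ m ≤ n_Lℓ_L` (`1 ≤ n_L`; hp-8's `hmodlo`/`hmodhi`). [folklore] -/
theorem modulus_top (κ : Consts) {V : Type} [DecidableEq V] [Countable V] {G : SimpleGraph V} [G.LocallyFinite] (Φ : PlanarSkeletonFrmFrom G) (t : V) (p : unitInterval) (D : Skelφ.StepI.DataNS V) (g : ℕ) (f : ℕ) (hn : 1 ≤ nL κ Φ t p D g f) :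
    (nL κ Φ t p D g f : ℤ) * ℓL κ Φ t p D g f - (shearUnit (nL κ Φ t p D g f) (hL κ Φ t p D g f) : ℤ) + 1 ≤
        modulus (nL κ Φ t p D g f) (hL κ Φ t p D g f) (vL κ Φ t p D g f) (vβL κ Φ t p D g f) ∧
      modulus (nL κ Φ t p D g f) (hL κ Φ t p D g f) (vL κ Φ t p D g f) (vβL κ Φ t p D g f) ≤ (nL κ Φ t p D g f : ℤ) * ℓL κ Φ t p D g f := by
  obtain ⟨h1, h2⟩ := Skelφ.NegPrm.modulus_vβOf hn (hL κ Φ t p D g f) (ℓL κ Φ t p D g f) (vL κ Φ t p D g f)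
  have hU : (nL κ Φ t p D g f : ℤ) ≤ (shearUnit (nL κ Φ t p D g f) (hL κ Φ t p D g f) : ℤ) := by
    simp only [Skelφ.shearUnit, Nat.cast_add, Int.natCast_natAbs]; linarith [abs_nonneg (hL κ Φ t p D g f)]
  exact ⟨by change _ ≤ modulus _ _ _ (Skelφ.NegPrm.vβOf _ _ _ _); linarith, h2⟩

end Lattice

/-! ## §2 The layer inequality at `g := gT` -/

namespace KS

section Layer

/-- **`hlay`** (hp-8's shape `(n_L + |h_L| : ℕ) ≤ n_L·ℓ_L + 1`) at `g := gT mk gx`, any `f` — one factor of `layer_T`'s `(RA′+3)·U_L ≤ n_Lℓ_L + 1`. [folklore] -/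
theorem hlay_T (κ : Consts) {V : Type} [DecidableEq V] [Countable V] {G : SimpleGraph V} [G.LocallyFinite] (Φ : PlanarSkeletonFrmFrom G) (t : V) (p : unitInterval) (D : Skelφ.StepI.DataNS V) (mk : ℕ) (gx : Neg.FSlot) (f : ℕ) (hN : EqNumL κ Φ t p D (gT mk gx κ Φ t p D) f) (hκ : (hL κ Φ t p D (gT mk gx κ Φ t p D) f).natAbs ≤ 10 * nL κ Φ t p D (gT mk gx κ Φ t p D) f) :
    ((nL κ Φ t p D (gT mk gx κ Φ t p D) f + (hL κ Φ t p D (gT mk gx κ Φ t p D) f).natAbs : ℕ) : ℤ) ≤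
      (nL κ Φ t p D (gT mk gx κ Φ t p D) f : ℤ) * ℓL κ Φ t p D (gT mk gx κ Φ t p D) f + 1 := by
  have h := layer_T κ Φ t p D mk gx f hN hκ
  have hU : (0 : ℤ) ≤ ((nL κ Φ t p D (gT mk gx κ Φ t p D) f + (hL κ Φ t p D (gT mk gx κ Φ t p D) f).natAbs : ℕ) : ℤ) := by positivity
  have hR : (1 : ℤ) ≤ (RA' κ Φ t p D mk : ℤ) + 3 := by omega
  nlinarith

end Layer

end KS

/-! ## §3 The foot reading for any base vertex -/

section Foot

/-- **`hnear₂`** (hp-8's binder shape, ANY base vertex `c`, ANY map `φ′`) at `kA := (kFoot₀ sα sβ, kFoot₁ sα sβ)`: a vertex within planar extents `(sα, sβ)`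
of `c` has fine position within `(kFoot₀, kFoot₁)` in the fine skeleton about `c`. [folklore] -/
theorem hnear₂_R (κ : Consts) {V : Type} [DecidableEq V] [Countable V] {G : SimpleGraph V} [G.LocallyFinite] (Φ : PlanarSkeletonFrmFrom G) (t : V) (p : unitInterval) (D : Skelφ.StepI.DataNS V) (g : ℕ) (f : ℕ) (hN : EqNumL κ Φ t p D g f) (sα sβ : ℤ) (φ' : V → Site 2) (c w : V) (h0 : |φ' w 0 - φ' c 0| ≤ sα) (h1 : |φ' w 1 - φ' c 1| ≤ sβ) :
    |Skelφ.fineSkel φ' c (prF κ Φ t p D g f).A ((prF κ Φ t p D g f).n : ℤ) (prF κ Φ t p D g f).h (prF κ Φ t p D g f).vα (prF κ Φ t p D g f).vβ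
        (prF κ Φ t p D g f).c₀ (prF κ Φ t p D g f).c₁ ((prF κ Φ t p D g f).D / 2) ((prF κ Φ t p D g f).D / 2) (prF κ Φ t p D g f).D w 0| ≤
        kFoot₀ κ Φ t p D g f sα sβ ∧
      |Skelφ.fineSkel φ' c (prF κ Φ t p D g f).A ((prF κ Φ t p D g f).n : ℤ) (prF κ Φ t p D g f).h (prF κ Φ t p D g f).vα (prF κ Φ t p D g f).vβ
        (prF κ Φ t p D g f).c₀ (prF κ Φ t p D g f).c₁ ((prF κ Φ t p D g f).D / 2) ((prF κ Φ t p D g f).D / 2) (prF κ Φ t p D g f).D w 1| ≤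
        kFoot₁ κ Φ t p D g f sα sβ := by
  obtain ⟨-, -, -, hc₀, hc₁, hD⟩ := prF_pos κ Φ t p D g f hN
  exact Skelφ.abs_fineSkel_le_of_near₂ (φ := φ') c hD hc₀.le hc₁.le (hL0_R κ Φ t p D g f sα sβ hN) (hL1_R κ Φ t p D g f sα sβ hN) h0 h1

end Foot

end NegB

end PlanarSkeletonFrmFrom

end Summit.CriticalPhenomena.PercolationContinuityZ3.Theorems.Transplant

end
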